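import Literature.NumberTheory.EllipticCurves.TwoAdicImageSurjectivity
import Literature.NumberTheory.EllipticCurves.TwoTorsionGaloisActionProofs
import Literature.NumberTheory.EllipticCurves.SelmerCorankProofs
import Mathlib.Algebra.CubicDiscriminant
import Mathlib.GroupTheory.Perm.Sign
import HarnessLib

/-!
# Dokchitser–Dokchitser 2012, Theorem, clause (1) — PROVED:
# `ρ̄_{E,2}` is onto `Aut(E[2])` iff `E(ℚ)` has no point of exact order `2` and `Δ ∉ ℚ^{×2}`

`Proofs` companion (theorems only; no named fact, no instance; D-0014/D-0026) of
`TwoAdicImageSurjectivity`, whose named fact `DokchitserDokchitser2012_surjective_mod_two_four_eight`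
records T. Dokchitser, V. Dokchitser, *Surjectivity of mod `2ⁿ` representations of elliptic curves*,
Math. Z. 272 (2012) 961–964, Theorem, as the conjunction of three clauses (criteria for `ρ̄₂`, `ρ̄₄`,
`ρ̄₈`). This file proves **clause (1)** in the kernel, byte-for-byte as stated there:

* `hasSurjectiveModNGaloisRep_two_iff` — for an elliptic curve `W/ℚ` (any Weierstrass model),
  `W.HasSurjectiveModNGaloisRep 2 ↔ (∀ P : W.toAffine.Point, 2 • P = 0 → P = 0) ∧ ¬ IsSquare W.Δ`.

THE PRINTED PROOF, FOLLOWED (proof of the Theorem, first paragraph = [corpus:paper:arxiv-1104.5031,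
chunk p0001 L51–L57]): "The `x`-coordinates of the three non-trivial
`2`-torsion points are the roots of `x³ + ax + b` and their `y`-coordinates are `0`. So `ρ̄₂`
surjects onto `GL₂(𝔽₂) ≅ S₃` if and only if this cubic is irreducible and its discriminant `Δ/16`
is not a square. Note that this proves (1) and that `ℚ(E[2])` contains `ℚ(√Δ)`." For an arbitrary
model the cubic is Mathlib's `2`-division cubic `4x³ + b₂x² + 2b₄x + b₆`
(`WeierstrassCurve.twoTorsionPolynomial`, of discriminant `16Δ`: `twoTorsionPolynomial_discr`), and
"irreducible" is spelled, as in the fact, "no rational point of exact order `2`" (a cubic is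
irreducible over `ℚ` iff it has no rational root). The argument, made explicit:

1. (helper file `TwoTorsionGaloisActionProofs`) `E[2] ∖ 0 = {T₀, T₁, T₂}` with `T₂ = T₀ + T₁`
   (frame `E[2] ≅ (ℤ/2)²`, Silverman *AEC* III.6.4(b)); an additive automorphism of `E[2]` IS a
   permutation of `{T₀, T₁, T₂}` (`perm`, injective), and `σ ↦ permGal σ` is multiplicative.
2. (§1) `x(T_i)` are three DISTINCT roots of the `2`-division cubic in `K̄`, hence ALL its roots,
   so by `Cubic.discr_eq_prod_three_roots` `Δ = 16 δ²` with
   `δ = (x₀ - x₁)(x₀ - x₂)(x₁ - x₂) ≠ 0` ("`ℚ(E[2]) ⊃ ℚ(√Δ)`"); and `σ δ = sign(permGal σ) · δ`.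
3. (§2) Hence `Δ ∈ K^{×2}` iff `δ ∈ K` iff every `σ` is EVEN on the letters (Galois theory of
   `K̄/K`, `K` perfect: `InfiniteGalois.mem_range_algebraMap_iff_fixed`); and "no `K`-rational point
   of order `2`" makes every letter `T_i` move under some `σ` (Galois descent of points, tree theorem
   `exists_toGeomPoints_eq_of_forall_smul_eq`, Silverman VIII.1).
4. (§3) A set of permutations of three letters closed under products which moves every letter and
   contains an odd one is all of `S₃` (kernel `decide`, §0 below); conversely `S₃` contains
   the transposition `(T₀ T₁)` (odd, so `δ ∉ K`) and an automorphism moving any given `T_i` (so no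
   `T_i` descends to `E(K)`).

Proved for every PERFECT field `K` with `2 ≠ 0`; the fact's clause is the case `K = ℚ`. Also: the
named fact follows from its clauses (2) and (3) taken as an explicit hypothesis
(`…_of_clauses_two_three`; no new named fact). Clauses (2) and (3) are not addressed here.

## References

* [DokchitserDokchitserMathZ2012] T. Dokchitser, V. Dokchitser, *Surjectivity of mod `2ⁿ`
  representations of elliptic curves*, Math. Z. 272 (2012) 961–964, Theorem (1) and its proof
  (first paragraph). [corpus:paper:arxiv-1104.5031, chunk p0001 L32–L57]
* [SilvermanAEC2009] J. H. Silverman, *The Arithmetic of Elliptic Curves*, 2nd ed., GTM 106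
  (2009), III.1 (the `2`-division cubic and its discriminant `16Δ`), III.6.4(b), III.7, VIII.1.
-/

set_option autoImplicit false

/-! ### §0. Permutations of three letters (kernel-decidable facts about `S₃`) -/

namespace Literature.NumberTheory.EllipticCurves.DokchitserDokchitser2012

set_option synthInstance.maxSize 2048 in
/-- `S₃` is generated, as a set of short words, by an odd permutation `g` together with any
permutation `h` moving a fixed point of `g`. [folklore] -/
private theorem perm_three_eq_word :
    ∀ g h : Equiv.Perm (Fin 3), Equiv.Perm.sign g = -1 → ∀ c : Fin 3, g c = c → h c ≠ c →
      ∀ k : Equiv.Perm (Fin 3), k = 1 ∨ k = g ∨ k = h ∨ k = g * h ∨ k = h * g ∨ k = g * h * g ∨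
        k = h * h ∨ k = h * g * h := by
  decide

/-- An odd permutation of three letters has a fixed point. [folklore] -/
private theorem perm_three_exists_fixed_of_sign_eq_neg_one :
    ∀ g : Equiv.Perm (Fin 3), Equiv.Perm.sign g = -1 → ∃ c : Fin 3, g c = c := by
  decide

end Literature.NumberTheory.EllipticCurves.DokchitserDokchitser2012

noncomputable section

open scoped Classical

open WeierstrassCurve

namespace Literature.NumberTheory.EllipticCurves.DokchitserDokchitser2012

universe u

variable {K : Type u} [Field K] (W : WeierstrassCurve K) [W.IsElliptic] (h2 : (2 : K) ≠ 0)

omit [W.IsElliptic] in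
include h2 in
/-- `2ⁿ ≠ 0` in `K̄` when `2 ≠ 0` in `K`. [folklore] -/
private theorem two_pow_ne_zero' (n : ℕ) : (2 : AlgebraicClosure K) ^ n ≠ 0 := by
  refine pow_ne_zero n fun h0 ↦ h2 ((algebraMap K (AlgebraicClosure K)).injective ?_)
  rw [map_ofNat, h0, map_zero]

/-! ### §1. `Δ = 16 δ²`: the roots of the `2`-division cubic -/

omit [W.IsElliptic] in
/-- The `2`-division cubic base-changes coefficientwise. [folklore] -/
private theorem map_twoTorsionPolynomial :
    Cubic.map (algebraMap K (AlgebraicClosure K)) W.twoTorsionPolynomial =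
      (W.baseChange (AlgebraicClosure K)).twoTorsionPolynomial := by
  simp only [Cubic.map, twoTorsionPolynomial, baseChange, map_b₂, map_b₄, map_b₆, map_ofNat, map_mul]

/-- **The roots of the `2`-division cubic are exactly `x₀, x₁, x₂`.** Silverman, *AEC*, III.§1
and Ex. 3.7. [cite: SilvermanAEC2009, Ex. III.3.7 (d) (roots of ψ₂² are the abscissae of E[2] ∖ O)] -/
theorem roots_twoTorsionPolynomial :
    (Cubic.map (algebraMap K (AlgebraicClosure K)) W.twoTorsionPolynomial).roots =
      {xT W h2 0, xT W h2 1, xT W h2 2} := by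
  rw [Cubic.roots, map_twoTorsionPolynomial]
  set P := (W.baseChange (AlgebraicClosure K)).twoTorsionPolynomial with hP
  have ha : P.a ≠ 0 := by
    change (4 : AlgebraicClosure K) ≠ 0
    rw [show (4 : AlgebraicClosure K) = 2 ^ 2 by norm_num]; exact two_pow_ne_zero' h2 2
  have hne : P.toPoly ≠ 0 := Cubic.ne_zero_of_a_ne_zero ha
  have hmem : ∀ i : Fin 3, xT W h2 i ∈ P.toPoly.roots := fun i ↦
    (Polynomial.mem_roots hne).mpr
      (isRoot_xco_of_add_self_eq_zero W (coe_T_ne_zero W h2 i) (coe_add_self_eq_zero W _))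
  have hnodup : ({xT W h2 0, xT W h2 1, xT W h2 2} : Multiset (AlgebraicClosure K)).Nodup := by
    simp [(xT_injective W h2).eq_iff]
  have hle : ({xT W h2 0, xT W h2 1, xT W h2 2} : Multiset (AlgebraicClosure K)) ≤ P.toPoly.roots := by
    rw [Multiset.le_iff_subset hnodup]
    intro a ha
    simp only [Multiset.insert_eq_cons, Multiset.mem_cons, Multiset.mem_singleton] at ha
    rcases ha with rfl | rfl | rfl <;> exact hmem _
  symm
  apply Multiset.eq_of_le_of_card_le hle
  calc P.toPoly.roots.card ≤ P.toPoly.natDegree := Polynomial.card_roots' _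
    _ = 3 := Cubic.natDegree_of_a_ne_zero ha
    _ = _ := by simp

/-- **`Δ = 16 δ²` in `K̄`** ("`ℚ(E[2]) ⊃ ℚ(√Δ)`"): the discriminant of `4x³ + b₂x² + 2b₄x + b₆` is
`16Δ` (Silverman, *AEC*, III.§1; Mathlib `twoTorsionPolynomial_discr`) and equals
`(4·4·δ)²` (`Cubic.discr_eq_prod_three_roots`). [cite: SilvermanAEC2009, III.§1] -/
theorem algebraMap_Δ : algebraMap K (AlgebraicClosure K) W.Δ = 16 * delta W h2 ^ 2 := by
  have ha : W.twoTorsionPolynomial.a ≠ 0 := by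
    change (4 : K) ≠ 0
    rw [show (4 : K) = 2 * 2 by norm_num]; exact mul_ne_zero h2 h2
  have h := Cubic.discr_eq_prod_three_roots ha (roots_twoTorsionPolynomial W h2)
  rw [twoTorsionPolynomial_discr, map_mul] at h
  have h4 : algebraMap K (AlgebraicClosure K) W.twoTorsionPolynomial.a = 4 := by
    rw [twoTorsionPolynomial]; exact map_ofNat _ 4
  rw [h4] at h
  have h16 : algebraMap K (AlgebraicClosure K) 16 = 16 := map_ofNat _ 16
  rw [h16] at h
  have h16' : (16 : AlgebraicClosure K) ≠ 0 := by
    rw [show (16 : AlgebraicClosure K) = 2 ^ 4 by norm_num]; exact two_pow_ne_zero' h2 4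
  apply mul_left_cancel₀ h16'
  rw [h, delta]
  ring

/-! ### §2. `Δ ∈ K^{×2}` iff every `σ` is even on `{T₀, T₁, T₂}`; rational `2`-torsion iff a fixed letter -/

/-- `σ δ = δ` iff `σ` induces an EVEN permutation of `{T₀, T₁, T₂}` (`δ ≠ 0`, `2 ≠ 0`). [folklore] -/
private theorem smul_delta_eq_self_iff (σ : Field.absoluteGaloisGroup K) :
    σ • delta W h2 = delta W h2 ↔ Equiv.Perm.sign (permGal W h2 σ) = 1 := by
  rw [smul_delta]
  rcases Int.units_eq_one_or (Equiv.Perm.sign (permGal W h2 σ)) with h | h <;> rw [h]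
  · simp
  · simp only [Units.val_neg, Units.val_one, Int.cast_neg, Int.cast_one, neg_mul, one_mul]
    constructor
    · intro hneg
      exfalso
      apply mul_ne_zero (pow_one (2 : AlgebraicClosure K) ▸ two_pow_ne_zero' h2 1)
        (delta_ne_zero W h2)
      linear_combination -hneg
    · intro h1
      exact absurd h1 (by decide)

/-- **`Δ ∈ K^{×2}` iff `δ` is fixed by `Γ_K`** (`K` perfect, `2 ≠ 0`): `Δ = 16δ² = (4δ)²`, and an
element of `K̄` lies in `K` iff it is `Γ_K`-fixed (`K̄/K` Galois). Dokchitser–Dokchitser, loc. cit.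
("its discriminant `Δ/16` is not a square"; "`ℚ(E[2])` contains `ℚ(√Δ)`").
[cite: DokchitserDokchitserMathZ2012, Theorem (1), proof (Δ/16 a square iff √Δ ∈ ℚ ⊂ ℚ(E[2]))] -/
theorem isSquare_Δ_iff_forall_smul_delta [PerfectField K] :
    IsSquare W.Δ ↔ ∀ σ : Field.absoluteGaloisGroup K, σ • delta W h2 = delta W h2 := by
  haveI : IsGalois K (AlgebraicClosure K) := {}
  have hΔ := algebraMap_Δ W h2
  constructor
  · rintro ⟨r, hr⟩ σ
    have hsq : (4 * delta W h2) ^ 2 = (algebraMap K (AlgebraicClosure K) r) ^ 2 := by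
      rw [← map_pow, pow_two r, ← hr, hΔ]; ring
    have hfix : ∀ q : K, σ • algebraMap K (AlgebraicClosure K) q = algebraMap K _ q := fun q ↦
      (show AlgebraicClosure K ≃ₐ[K] AlgebraicClosure K from σ).commutes q
    have h4ne : (4 : AlgebraicClosure K) ≠ 0 := by
      rw [show (4 : AlgebraicClosure K) = 2 ^ 2 by norm_num]; exact two_pow_ne_zero' h2 2
    rcases eq_or_eq_neg_of_sq_eq_sq _ _ hsq with h | h
    · have hd : delta W h2 = algebraMap K (AlgebraicClosure K) (r / 4) := by
        rw [map_div₀, map_ofNat, eq_div_iff h4ne]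
        linear_combination h
      rw [hd, hfix]
    · have hd : delta W h2 = algebraMap K (AlgebraicClosure K) (-r / 4) := by
        rw [map_div₀, map_neg, map_ofNat, eq_div_iff h4ne]
        linear_combination h
      rw [hd, hfix]
  · intro hfix
    obtain ⟨q, hq⟩ := (InfiniteGalois.mem_range_algebraMap_iff_fixed (delta W h2)).mpr
      (fun σ ↦ hfix σ)
    refine ⟨4 * q, (algebraMap K (AlgebraicClosure K)).injective ?_⟩
    rw [hΔ, ← hq, map_mul, map_mul, map_ofNat]
    ring

/-- **"No `K`-rational point of exact order `2`" forces every letter `T_i` to be moved by some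
`σ ∈ Γ_K`** (`K` perfect): a `Γ_K`-fixed `T_i` descends to `E(K)` (Silverman, *AEC*, VIII.§1;
tree theorem `exists_toGeomPoints_eq_of_forall_smul_eq`), where it is a point of order `2`.
[cite: SilvermanAEC2009, VIII.§1] -/
theorem exists_smul_T_ne [PerfectField K] (hno2 : ∀ P : W.toAffine.Point, 2 • P = 0 → P = 0)
    (i : Fin 3) : ∃ σ : Field.absoluteGaloisGroup K, σ • T W h2 i ≠ T W h2 i := by
  by_contra hall
  push Not at hall
  have hfix : ∀ σ : Field.absoluteGaloisGroup K, σ • (T W h2 i : geomPoints W) = T W h2 i :=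
    fun σ ↦ by rw [← AddSubgroup.torsionBy.coe_smul, hall σ]
  obtain ⟨P, hP⟩ := exists_toGeomPoints_eq_of_forall_smul_eq W hfix
  have h2P : 2 • P = 0 := toGeomPoints_injective W (by
    rw [map_nsmul, map_zero, hP, two_nsmul]; exact coe_add_self_eq_zero W _)
  have hP0 : P = 0 := hno2 P h2P
  rw [hP0, map_zero] at hP
  exact coe_T_ne_zero W h2 i hP.symm

/-! ### §3. The theorem -/

/-- The set of permutations of `{T₀, T₁, T₂}` realised by `Γ_K` is closed under products. [folklore] -/
private theorem mul_mem_range_permGal {p q : Equiv.Perm (Fin 3)} (hp : p ∈ Set.range (permGal W h2))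
    (hq : q ∈ Set.range (permGal W h2)) : p * q ∈ Set.range (permGal W h2) := by
  obtain ⟨σ, rfl⟩ := hp
  obtain ⟨τ, rfl⟩ := hq
  exact ⟨σ * τ, permGal_mul W h2 σ τ⟩

include h2 in
/-- **Dokchitser–Dokchitser (1), "if": no `K`-rational point of order `2` and `Δ ∉ K^{×2}` make
`ρ̄_{E,2}` onto** (`K` perfect, `char K ≠ 2`). Print: "`ρ̄₂` surjects onto `GL₂(𝔽₂) ≅ S₃` if …
this cubic is irreducible and its discriminant `Δ/16` is not a square." Proof: some `τ` is odd on
`{T₀, T₁, T₂}` (`Δ ∉ K^{×2}`), i.e. a transposition with fixed letter `c`; some `σ` moves `T_c` (no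
rational `2`-torsion); the realised permutations are closed under products, so they are all of
`S₃` (`perm_three_eq_word`); and an automorphism of `E[2]` IS a permutation of the `T_i`.
[cite: DokchitserDokchitserMathZ2012, Theorem (1), proof (first paragraph)] -/
theorem hasSurjectiveModNGaloisRep_two_of [PerfectField K]
    (hno2 : ∀ P : W.toAffine.Point, 2 • P = 0 → P = 0) (hΔ : ¬ IsSquare W.Δ) :
    W.HasSurjectiveModNGaloisRep 2 := by
  -- an odd `τ`
  rw [isSquare_Δ_iff_forall_smul_delta W h2] at hΔ
  push Not at hΔ
  obtain ⟨τ, hτ⟩ := hΔ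
  have hg : Equiv.Perm.sign (permGal W h2 τ) = -1 := by
    rcases Int.units_eq_one_or (Equiv.Perm.sign (permGal W h2 τ)) with h | h
    · exact absurd ((smul_delta_eq_self_iff W h2 τ).mpr h) hτ
    · exact h
  set g := permGal W h2 τ with hgdef
  -- its fixed letter `c`, and a `σ` moving `T_c`
  obtain ⟨c, hc⟩ := perm_three_exists_fixed_of_sign_eq_neg_one g hg
  obtain ⟨σ, hσ⟩ := exists_smul_T_ne W h2 hno2 c
  set h := permGal W h2 σ with hhdef
  have hhc : h c ≠ c := fun e ↦ hσ (by rw [← T_permGal, ← hhdef, e])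
  -- every permutation is realised
  have hgR : g ∈ Set.range (permGal W h2) := ⟨τ, rfl⟩
  have hhR : h ∈ Set.range (permGal W h2) := ⟨σ, rfl⟩
  have h1R : (1 : Equiv.Perm (Fin 3)) ∈ Set.range (permGal W h2) := ⟨1, permGal_one W h2⟩
  have hall : ∀ k : Equiv.Perm (Fin 3), k ∈ Set.range (permGal W h2) := by
    intro k
    rcases perm_three_eq_word g h hg c hc hhc k with rfl | rfl | rfl | rfl | rfl | rfl | rfl | rfl
    · exact h1R
    · exact hgR
    · exact hhR
    · exact mul_mem_range_permGal W h2 hgR hhR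
    · exact mul_mem_range_permGal W h2 hhR hgR
    · exact mul_mem_range_permGal W h2 (mul_mem_range_permGal W h2 hgR hhR) hgR
    · exact mul_mem_range_permGal W h2 hhR hhR
    · exact mul_mem_range_permGal W h2 (mul_mem_range_permGal W h2 hhR hgR) hhR
  -- hence every additive automorphism of `E[2]` is some `ρ̄₂(σ')`
  intro y
  obtain ⟨σ', hσ'⟩ := hall (perm W h2 y.toAdd)
  refine ⟨σ', Multiplicative.toAdd.injective ?_⟩
  change rho W σ' = y.toAdd
  exact perm_injective W h2 hσ'

include h2 in
/-- **Dokchitser–Dokchitser (1), "only if", first half: `ρ̄_{E,2}` onto excludes a `K`-rational point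
of order `2`** (`char K ≠ 2`): such a point is a nonzero `Γ_K`-fixed `Q ∈ E[2]`, but some automorphism
of `E[2]` moves `Q`. [cite: DokchitserDokchitserMathZ2012, Theorem (1), proof (first paragraph)] -/
theorem forall_two_nsmul_of_hasSurjectiveModNGaloisRep_two (hs : W.HasSurjectiveModNGaloisRep 2)
    (P : W.toAffine.Point) (h2P : 2 • P = 0) : P = 0 := by
  by_contra hP0
  have hmem : toGeomPoints W P ∈ geomTorsion W 2 := by
    rw [mem_geomTorsion_two_iff, ← map_add, ← two_nsmul, h2P, map_zero]
  set Q : geomTorsion W 2 := ⟨toGeomPoints W P, hmem⟩ with hQdef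
  have hQ0 : Q ≠ 0 := fun h ↦ hP0 (toGeomPoints_injective W (by
    rw [map_zero]; exact congrArg Subtype.val h))
  have hfix : ∀ σ : Field.absoluteGaloisGroup K, σ • Q = Q := fun σ ↦
    Subtype.ext (smul_toGeomPoints W σ P)
  obtain ⟨φ, hφ⟩ := exists_addEquiv_apply_ne W h2 hQ0
  obtain ⟨σ, hσ⟩ := hs (Multiplicative.ofAdd φ)
  apply hφ
  have := galoisRepTorsion_apply W 2 σ Q
  rw [hσ, toAdd_ofAdd, hfix] at this
  exact this

include h2 in
/-- **Dokchitser–Dokchitser (1), "only if", second half: `ρ̄_{E,2}` onto forces `Δ ∉ K^{×2}`**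
(`K` perfect, `char K ≠ 2`): the transposition `T₀ ↔ T₁` is some `σ`, which then moves
`δ = √(Δ/16)` to `-δ`. [cite: DokchitserDokchitserMathZ2012, Theorem (1), proof (first paragraph)] -/
theorem not_isSquare_Δ_of_hasSurjectiveModNGaloisRep_two [PerfectField K]
    (hs : W.HasSurjectiveModNGaloisRep 2) : ¬ IsSquare W.Δ := by
  intro hsq
  rw [isSquare_Δ_iff_forall_smul_delta W h2] at hsq
  obtain ⟨σ, hσ⟩ := hs (Multiplicative.ofAdd (swapAut W h2))
  have hρ : rho W σ = swapAut W h2 := by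
    change (galoisRepTorsion W 2 σ).toAdd = swapAut W h2
    rw [hσ, toAdd_ofAdd]
  have hsign : Equiv.Perm.sign (permGal W h2 σ) = -1 := by
    rw [permGal, hρ, perm_swapAut, Equiv.Perm.sign_swap (by decide)]
  have h1 := (smul_delta_eq_self_iff W h2 σ).mp (hsq σ)
  rw [hsign] at h1
  exact absurd h1 (by decide)

include h2 in
/-- **Dokchitser–Dokchitser 2012, Theorem, clause (1), over any perfect field `K` with
`char K ≠ 2`:** `ρ̄_{E,2} : Γ_K → Aut(E[2])` is onto iff `E(K)` has no point of exact order `2` and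
`Δ ∉ K^{×2}`. [cite: DokchitserDokchitserMathZ2012, Theorem (1)] -/
theorem hasSurjectiveModNGaloisRep_two_iff_of_two_ne_zero [PerfectField K] :
    W.HasSurjectiveModNGaloisRep 2 ↔
      (∀ P : W.toAffine.Point, 2 • P = 0 → P = 0) ∧ ¬ IsSquare W.Δ :=
  ⟨fun hs ↦ ⟨forall_two_nsmul_of_hasSurjectiveModNGaloisRep_two W h2 hs,
    not_isSquare_Δ_of_hasSurjectiveModNGaloisRep_two W h2 hs⟩,
    fun h ↦ hasSurjectiveModNGaloisRep_two_of W h2 h.1 h.2⟩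

end Literature.NumberTheory.EllipticCurves.DokchitserDokchitser2012

namespace Literature.NumberTheory.EllipticCurves

/-- **Dokchitser–Dokchitser 2012, Theorem, clause (1) (`E/ℚ`) — PROVED.** For an elliptic curve
`E/ℚ` (any Weierstrass model `W`), `ρ̄_{E,2} : Γ_ℚ → Aut(E[2])` is onto if and only if `E(ℚ)` has no
point of exact order `2` and `Δ ∉ ℚ^{×2}`: "`ρ̄₂` is surjective ⟺ `x³ + ax + b` is irreducible and
`Δ ∉ ℚ^{×2}`" (the `2`-division cubic has degree `3`, so "irreducible" ⟺ "no rational root" ⟺ "no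
rational point of exact order `2`"). This is conjunct (1) of the named fact
`DokchitserDokchitser2012_surjective_mod_two_four_eight`, with the same spelling.
[cite: DokchitserDokchitserMathZ2012, Theorem (1) (p. 961) and its proof, first paragraph] -/
theorem hasSurjectiveModNGaloisRep_two_iff (W : WeierstrassCurve ℚ) [W.IsElliptic] :
    W.HasSurjectiveModNGaloisRep 2 ↔
      (∀ P : W.toAffine.Point, 2 • P = 0 → P = 0) ∧ ¬ IsSquare W.Δ := by
  haveI : PerfectField ℚ := PerfectField.ofCharZero
  -- (`convert` bridges Mathlib's two `DecidableEq ℚ` instances behind the group law on `E(ℚ)`)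
  convert DokchitserDokchitser2012.hasSurjectiveModNGaloisRep_two_iff_of_two_ne_zero W two_ne_zero

/-- Clause (1) of `DokchitserDokchitser2012_surjective_mod_two_four_eight`, in the fact's own
quantifier shape (`∀ W [IsElliptic], …`). [cite: DokchitserDokchitserMathZ2012, Theorem (1)] -/
theorem DokchitserDokchitser2012_surjective_mod_two_iff :
    ∀ (W : WeierstrassCurve ℚ) [W.IsElliptic],
      W.HasSurjectiveModNGaloisRep 2 ↔
        (∀ P : W.toAffine.Point, 2 • P = 0 → P = 0) ∧ ¬ IsSquare W.Δ :=
  fun W _ ↦ hasSurjectiveModNGaloisRep_two_iff W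

/-- **The named fact reduced to its clauses (2) and (3).** Granted, for every elliptic `W/ℚ`, the
printed criteria for `ρ̄₄` and `ρ̄₈` (Dokchitser–Dokchitser, Theorem (2), (3), copied verbatim from
`DokchitserDokchitser2012_surjective_mod_two_four_eight`; NOT proved here — the hypothesis `h`), the
whole fact follows, clause (1) being the kernel theorem `hasSurjectiveModNGaloisRep_two_iff`
(no new named fact). [cite: DokchitserDokchitserMathZ2012, Theorem (1)–(3)] -/
theorem DokchitserDokchitser2012_surjective_mod_two_four_eight_of_clauses_two_three
    (h : ∀ (W : WeierstrassCurve ℚ) [W.IsElliptic],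
      (W.HasSurjectiveModNGaloisRep 4 ↔
        W.HasSurjectiveModNGaloisRep 2 ∧ ¬ IsSquare (-W.Δ) ∧
          ∀ t : ℚ, W.j ≠ -4 * t ^ 3 * (t + 8)) ∧
      (W.HasSurjectiveModNGaloisRep 8 ↔
        W.HasSurjectiveModNGaloisRep 4 ∧ ¬ IsSquare (2 * W.Δ) ∧ ¬ IsSquare (-2 * W.Δ))) :
    DokchitserDokchitser2012_surjective_mod_two_four_eight :=
  fun W _ ↦ ⟨hasSurjectiveModNGaloisRep_two_iff W, h W⟩

end Literature.NumberTheory.EllipticCurves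

end
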